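import Summits.QuantumFields.BalabanUV.Beta.GAN24.CombContactGaugeStaircase
import Summits.QuantumFields.BalabanUV.Beta.GAN24.CombFacePotentialCauchy
import Summits.QuantumFields.BalabanUV.Beta.GAN24.ContactGaugeStaircaseCauchyPack

/-!
# `BalabanUV.Beta.GAN24.CombContactGaugeStaircaseCauchy` — binder row G-an2-4 ∕ (CONV-C), TRANSFER-III, the (III′) S-slot (b) of the END R `CombChargeRowsClosed`, the (III′) WILSON
# CONTACT RATE END `hCTd′` (M.104's second hypothesis) and the born-Λ pair letter `hPc`, step CT-4b AT THE COMB CHART: **THE CONJUGATED BOND GAUGE STAIRCASES OF TWO CONSECUTIVE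
# TOWERS, TOP-ALIGNED, DIFFER BY A STAIRCASE WHOSE PER-SCALE LETTERS ARE `θ^k ×` THE UNDIFFERENCED ONES — plus the taller tower's TWO extra finest pieces (the (E) one at scale `0`,
# the face one at scale `1`)** — the (III′) twin of road-P2 g34's `ContactGaugeStaircaseCauchy` ∕ `…Pack` §A for MY one-scale-longer staircase `λ′ = Ψ + PsiFace − bmGauge`
# (`CombContactGaugeStaircase`): identities (generic `d`) + parametric letters (`d = 3`; (N1) `C, κ₀`, CT-4a `c, θ, κ₁`, face letter `F ≥ faceWtSum r Lc`).

NOT IN PRINT; OUR BOOKKEEPING (G-an2-4 formalisation swarm, leaf prover `b2b-balaban-gan24-formalise-leaf-01`, gen 89; [folklore] finite-sum bookkeeping BY NAME over road-P2's (E)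
`gauge_eq_staircase_zero ∕ gauge_refine_eq_staircase ∕ gauge_coarse_eq_staircase_fine ∕ gauge_succ_sub_eq_staircase` and their letters, the OWNER's `PsiFace_apply_eq_sum ∕
abs_facePotential_legChain_single_le`, MY `CombFacePotentialCauchy.abs_facePotential_legChain_succ_sub_le`; 0 `def`, 0 cited facts, 0 `def … : Prop`, 0 sorry).
HONEST FRAMING (cell contract, verbatim): «discharging `BetaPertH` makes Bałaban's UV stability UNCONDITIONAL — a real constructive-QFT result; it is NOT the continuum limit and NOT
the Clay problem.»  HONEST DEPENDENCY (verbatim): «continuum YM on T⁴ ⇐ BetaPertH ∧ nine spine estimates (0/9 proved); BetaPertH ⇐ (D1) ∧ (D4) ∧ CAP+tail; G-an2-4 gates asym, D1 and NE2/3/4.»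

WHAT (`λ′^{(m,k)} u := Psi ρ Lc m k δ u + PsiFace r ρ Lc m k δ u − bmGaugeAt ρ (respStep (Lc^m) (Lc^(m+k+1)) μ z) Lc u`, `δ = delta1 μ z`, `R = respStepBmSeq ρ Lc`, `ζ = zetaS (toSite r) Lc`,
`w = |box Lc|⁻¹`; face pieces written through `facePotential_apply`):
* §1 (generic `d`) **`combGauge_succ_sub_eq_staircase`** (born alignment `(m+1,k) ↔ (m,k)`, same lattice: `λ′^{(m+1,k)} u − λ′^{(m,k)} u = Σ_{s<k+2} D′ s (blk (Lc^s) u)`, `D′` = road-P2's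
  `D` for `s ≤ k` ⊕ `(Lc^{(d+1)(s−1)})⁻¹·w·(ζ (legAct (legChain R (m+1+(s−1)) (k−(s−1))) δ) − ζ (legAct (legChain R (m+(s−1)) (k−(s−1))) δ))` for `s ≥ 1`);
  **`combGauge_refine_eq_staircase`** (top alignment `(0,k+1) ↔ (0,k)` across one refinement: `λ′^{(0,k+1)} u′ − (Lc^{d+1})⁻¹·λ′^{(0,k)} (blk Lc u′) = Σ_{s′<k+3} ΔG′ s′ (blk (Lc^{s′}) u′)`,
  `ΔG′` = road-P2's `ΔG` for `s′ ≤ k+1` ⊕ the face EXTRA finest piece `w·ζ (legAct (legChain R 0 (k+1)) δ)` at `s′ = 1` ⊕ `(Lc^{(d+1)(s′−1)})⁻¹·w·(ζ (legChain R (s′−1) (k+2−s′) δ) −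
  ζ (legChain R (s′−2) (k+2−s′) δ))` for `s′ ≥ 2`); **`combGauge_coarse_eq_staircase_fine`** (the shorter tower transported IS a `(k+3)`-staircase).
* §2 (`d = 3`) the letters: `abs_combPieceSucc_le` (`≤ (8Lc + F·c₁(κ₁))·(c·θ^{m+k})·(Lc^{5(k+1)})⁻¹·Lc^s·e^{−κ₁…}`), `abs_combPieceDiff_le` (`2 ≤ s′ ≤ k+2`: `θ^k ×`), `abs_combPieceDiff_one_le` ∕
  `abs_combPieceDiff_zero_le` (the two extra finest pieces: (N1) letters, NOT small by `θ^k`), `abs_combPieceUp_le`.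
NO new estimate; discharges NOTHING of (hS, hSall); NEVER «G-an2-4 closed» as (CONV-C); NOT D1, NOT BetaPertH, NOT continuum, NOT Clay.  2026-08-28; no existing file touched.
-/

noncomputable section

open Finset
open scoped BigOperators
open Literature.MathematicalPhysics.QuantumFieldTheory
open Literature.MathematicalPhysics.QuantumFieldTheory.LatticeForm (quo)
open Literature.MathematicalPhysics.QuantumFieldTheory.Balaban1983to89
open Literature.MathematicalPhysics.QuantumFieldTheory.Balaban1983to89.Beta
open B4ContourShift (supNorm supNorm_nonneg)
open AffineAveraging (Form0 Form1 Site box toSite)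
open AveragingContours (blk)
open KKTFluctuationKernel (delta1)
open BalabanCompositeJets (respStep)
open Summit.QuantumFields.BalabanUV.Beta.AxialProjectorBlockMean (bmGaugeAt)
open Summit.QuantumFields.BalabanUV.Beta.SymCorrectorForms (zetaS)
open Summit.QuantumFields.BalabanUV.Beta.SymCorrectorFace (faceWtSum faceWtSum_nonneg)
open Summit.QuantumFields.BalabanUV.Beta.GAN24.Push4Iter (legChain)
open Summit.QuantumFields.BalabanUV.Beta.GAN24.RespStepBmDecomp (blk_blk)
open Summit.QuantumFields.BalabanUV.Beta.GAN24.RespStepBmDecompLegs (legAct)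
open Summit.QuantumFields.BalabanUV.Beta.GAN24.RespStepBmDecompExact (respStepBmSeq blk_blk_pow)
open Summit.QuantumFields.BalabanUV.Beta.GAN24.RespStepBmDecompPsi (Psi)
open Summit.QuantumFields.BalabanUV.Beta.GAN24.DressedLegEnvelope (blk_pow_blk_pow single_eq_delta1)
open Summit.QuantumFields.BalabanUV.Beta.GAN24.StaircaseFaces (blk_one)
open Summit.QuantumFields.BalabanUV.Beta.GAN24.ContactGaugeStaircaseCauchy (gauge_eq_staircase_uniform gauge_refine_eq_staircase gauge_coarse_eq_staircase_fine
  abs_gaugePieceDiff_le abs_gaugePieceDiff_zero_le abs_gaugePieceUp_le abs_gaugePieceZero_le blk_blk_blk_eq_quo)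
open Summit.QuantumFields.BalabanUV.Beta.GAN24.ContactGaugeStaircaseCauchyPack (gauge_succ_sub_eq_staircase abs_gaugePieceSucc_le)
open Summit.QuantumFields.BalabanUV.Beta.GAN24.CombLegChainGauge (PsiFace facePotential facePotential_apply)
open Summit.QuantumFields.BalabanUV.Beta.GAN24.CombLegFaceSawtoothBlockL1 (PsiFace_apply_eq_sum abs_facePotential_legChain_single_le)
open Summit.QuantumFields.BalabanUV.Beta.GAN24.CombFacePotentialCauchy (abs_facePotential_legChain_succ_sub_le)
open Summit.QuantumFields.BalabanUV.Beta.GAN24.ContactKernelCells (legAct_delta1_eq)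
open Summit.QuantumFields.BalabanUV.Beta.GAN24.CombContactGaugeStaircase (combGauge_eq_staircase)

namespace Summit.QuantumFields.BalabanUV.Beta.GAN24.CombContactGaugeStaircaseCauchy

variable {d : ℕ} {Lc : ℕ} [NeZero Lc]

/-! ## §1 The staircase identities (generic `d`, every root pair) -/

/-- [folklore] **THE FACE PART ALONE IS A STAIRCASE WITH ZERO FINEST PIECE** (generic `d`, every `r ρ m k b u`): `PsiFace r ρ Lc m k b u = Σ_{s<k+2} Φ s (blk (Lc^s) u)`,
`Φ 0 = 0`, `Φ s y = (Lc^{(d+1)(s−1)})⁻¹·|box Lc|⁻¹·ζ_S (legAct (legChain R (m+(s−1)) (k−(s−1))) b) y` (`s ≥ 1`) — the OWNER's `PsiFace_apply_eq_sum` read one scale up. -/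
theorem PsiFace_eq_staircase (r : Fin (d + 1) → ℕ) (ρ : Fin (d + 1) → ℤ) (m k : ℕ) (b : Form1 (d + 1) ℝ) (u : Site (d + 1)) :
    PsiFace r ρ Lc m k b u
      = ∑ s ∈ Finset.range (k + 1 + 1),
          (fun (s : ℕ) (y : Site (d + 1)) =>
            if s = 0 then (0 : ℝ)
            else ((Lc : ℝ) ^ ((d + 1) * (s - 1)))⁻¹ * ((((box (d + 1) Lc).card : ℝ))⁻¹ *
              zetaS (toSite r) Lc (legAct (legChain (respStepBmSeq (d := d) ρ Lc) (m + (s - 1)) (k - (s - 1))) b) y)) s (blk (Lc ^ s) u) := by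
  rw [PsiFace_apply_eq_sum ρ k m b u, Finset.sum_range_succ' _ (k + 1)]
  simp only [Nat.succ_ne_zero, ↓reduceIte, add_zero, Nat.add_sub_cancel]
  exact Finset.sum_congr rfl fun i _ => by rw [facePotential_apply, blk_blk_pow]

/-- [folklore] **THE FACE PART OF THE SHORTER TOWER, TRANSPORTED TO THE FINE′ LATTICE, IS A `(k+3)`-STAIRCASE WITH TWO ZERO FINEST PIECES** (generic `d`, every `r ρ k b u′`):
`(Lc^{d+1})⁻¹·PsiFace r ρ Lc 0 k b (blk Lc u′) = Σ_{s′<k+3} Φup s′ (blk (Lc^{s′}) u′)`, `Φup s′ = 0` (`s′ ≤ 1`),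
`Φup s′ y = (Lc^{(d+1)(s′−1)})⁻¹·|box Lc|⁻¹·ζ_S (legAct (legChain R (s′−2) (k+2−s′)) b) y` (`s′ ≥ 2`) — the currency factor `Lc^{−(d+1)}` absorbed EXACTLY. -/
theorem PsiFace_coarse_eq_staircase_fine (r : Fin (d + 1) → ℕ) (ρ : Fin (d + 1) → ℤ) (k : ℕ) (b : Form1 (d + 1) ℝ) (u' : Site (d + 1)) :
    ((Lc : ℝ) ^ (d + 1))⁻¹ * PsiFace r ρ Lc 0 k b (blk Lc u')
      = ∑ s' ∈ Finset.range (k + 2 + 1),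
          (fun (s' : ℕ) (y : Site (d + 1)) =>
            if s' ≤ 1 then (0 : ℝ)
            else ((Lc : ℝ) ^ ((d + 1) * (s' - 1)))⁻¹ * ((((box (d + 1) Lc).card : ℝ))⁻¹ *
              zetaS (toSite r) Lc (legAct (legChain (respStepBmSeq (d := d) ρ Lc) (s' - 2) (k + 2 - s')) b) y)) s' (blk (Lc ^ s') u') := by
  rw [PsiFace_apply_eq_sum ρ k 0 b (blk Lc u'), Finset.mul_sum, Finset.sum_range_succ' _ (k + 2), Finset.sum_range_succ' _ (k + 1)]
  simp only [zero_le, ↓reduceIte, add_zero, Nat.succ_le_succ_iff, Nat.le_zero, Nat.succ_ne_zero, Nat.zero_add]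
  refine Finset.sum_congr rfl fun i _ => ?_
  rw [facePotential_apply, blk_blk, blk_blk, show Lc * (Lc ^ i * Lc) = Lc ^ (i + 1 + 1) by ring, show i + 1 + 1 - 2 = i by omega,
    show k + 2 - (i + 1 + 1) = k - i by omega, show i + 1 + 1 - 1 = i + 1 by omega,
    show (d + 1) * (i + 1) = (d + 1) * i + (d + 1) by ring, pow_add, mul_inv]
  ring

/-- NOT IN PRINT; OUR BOOKKEEPING.  **THE BORN ALIGNMENT `(m+1, k) ↔ (m, k)` FOR THE CONJUGATED GAUGE FUNCTION** (generic `d`, every root pair, every `m k μ z u`; SAME lattice, no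
refinement, no extra piece): `λ′^{(m+1,k)} u − λ′^{(m,k)} u = Σ_{s<k+2} D′ s (blk (Lc^s) u)` — road-P2's `gauge_succ_sub_eq_staircase` (scales `≤ k`) ⊕ the face staircases of the two
towers subtracted scale by scale (`PsiFace_eq_staircase`). -/
theorem combGauge_succ_sub_eq_staircase (r : Fin (d + 1) → ℕ) (ρ : Fin (d + 1) → ℤ) (m k : ℕ) (μ : Fin (d + 1)) (z u : Site (d + 1)) :
    (Psi ρ Lc (m + 1) k (delta1 μ z) u + PsiFace r ρ Lc (m + 1) k (delta1 μ z) u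
        - bmGaugeAt ρ (respStep (d := d) (Lc ^ (m + 1)) (Lc ^ (m + 1 + k + 1)) μ z) Lc u)
      - (Psi ρ Lc m k (delta1 μ z) u + PsiFace r ρ Lc m k (delta1 μ z) u
        - bmGaugeAt ρ (respStep (d := d) (Lc ^ m) (Lc ^ (m + k + 1)) μ z) Lc u)
      = ∑ s ∈ Finset.range (k + 1 + 1),
          (fun (s : ℕ) (y : Site (d + 1)) =>
            (if s ≤ k then
              -(((Lc : ℝ) ^ ((d + 1) * s))⁻¹ *
                bmGaugeAt ρ (legAct (respStep (d := d) (Lc ^ (m + 1 + s)) (Lc ^ (m + 1 + k + 1))) (delta1 μ z)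
                  - legAct (respStep (d := d) (Lc ^ (m + s)) (Lc ^ (m + k + 1))) (delta1 μ z)) Lc y)
             else 0)
            + (if s = 0 then (0 : ℝ)
               else ((Lc : ℝ) ^ ((d + 1) * (s - 1)))⁻¹ * ((((box (d + 1) Lc).card : ℝ))⁻¹ *
                 (zetaS (toSite r) Lc (legAct (legChain (respStepBmSeq (d := d) ρ Lc) (m + 1 + (s - 1)) (k - (s - 1))) (delta1 μ z)) y
                  - zetaS (toSite r) Lc (legAct (legChain (respStepBmSeq (d := d) ρ Lc) (m + (s - 1)) (k - (s - 1))) (delta1 μ z)) y))))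
            s (blk (Lc ^ s) u) := by
  have hE := gauge_succ_sub_eq_staircase (Lc := Lc) ρ m k μ z u
  have hF1 := PsiFace_eq_staircase (Lc := Lc) r ρ (m + 1) k (delta1 μ z) u
  have hF0 := PsiFace_eq_staircase (Lc := Lc) r ρ m k (delta1 μ z) u
  rw [show (Psi ρ Lc (m + 1) k (delta1 μ z) u + PsiFace r ρ Lc (m + 1) k (delta1 μ z) u
        - bmGaugeAt ρ (respStep (d := d) (Lc ^ (m + 1)) (Lc ^ (m + 1 + k + 1)) μ z) Lc u)
      - (Psi ρ Lc m k (delta1 μ z) u + PsiFace r ρ Lc m k (delta1 μ z) u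
        - bmGaugeAt ρ (respStep (d := d) (Lc ^ m) (Lc ^ (m + k + 1)) μ z) Lc u)
      = ((Psi ρ Lc (m + 1) k (delta1 μ z) u - bmGaugeAt ρ (respStep (d := d) (Lc ^ (m + 1)) (Lc ^ (m + 1 + k + 1)) μ z) Lc u)
          - (Psi ρ Lc m k (delta1 μ z) u - bmGaugeAt ρ (respStep (d := d) (Lc ^ m) (Lc ^ (m + k + 1)) μ z) Lc u))
        + (PsiFace r ρ Lc (m + 1) k (delta1 μ z) u - PsiFace r ρ Lc m k (delta1 μ z) u) by ring,
    hE, hF1, hF0, ← Finset.sum_sub_distrib]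
  simp only [Finset.sum_add_distrib]
  congr 1
  · rw [Finset.sum_range_succ _ (k + 1), if_neg (show ¬ (k + 1 ≤ k) by omega), add_zero]
    exact Finset.sum_congr rfl fun s hs => by rw [if_pos (Nat.lt_succ_iff.1 (Finset.mem_range.1 hs))]
  · refine Finset.sum_congr rfl fun s _ => ?_
    by_cases h0 : s = 0
    · simp only [h0, ↓reduceIte, sub_zero]
    · simp only [h0, ↓reduceIte]
      ring

/-- NOT IN PRINT; OUR BOOKKEEPING.  **THE SHORTER TOWER's CONJUGATED STAIRCASE, TRANSPORTED TO THE FINE′ LATTICE, IS A `(k+3)`-STAIRCASE WITH ZERO FINEST PIECES** (generic `d`,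
every root pair, every `k μ z u′`): `(Lc^{d+1})⁻¹·λ′^{(0,k)} (blk Lc u′) = Σ_{s′<k+3} Gup′ s′ (blk (Lc^{s′}) u′)` — road-P2's `gauge_coarse_eq_staircase_fine` (scales `1 … k+1`) ⊕
the face staircase read one more scale up (scales `2 … k+2`). -/
theorem combGauge_coarse_eq_staircase_fine (r : Fin (d + 1) → ℕ) (ρ : Fin (d + 1) → ℤ) (k : ℕ) (μ : Fin (d + 1)) (z u' : Site (d + 1)) :
    ((Lc : ℝ) ^ (d + 1))⁻¹ *
        (Psi ρ Lc 0 k (delta1 μ z) (blk Lc u') + PsiFace r ρ Lc 0 k (delta1 μ z) (blk Lc u')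
          - bmGaugeAt ρ (respStep (d := d) 1 (Lc ^ (k + 1)) μ z) Lc (blk Lc u'))
      = ∑ s' ∈ Finset.range (k + 2 + 1),
          (fun (s' : ℕ) (y : Site (d + 1)) =>
            (if s' = 0 then (0 : ℝ)
             else if s' ≤ k + 1 then
               -(((Lc : ℝ) ^ ((d + 1) * s'))⁻¹ *
                 bmGaugeAt ρ (legAct (respStep (d := d) (Lc ^ (s' - 1)) (Lc ^ (k + 1))) (delta1 μ z)) Lc y)
             else 0)
            + (if s' ≤ 1 then (0 : ℝ)
               else ((Lc : ℝ) ^ ((d + 1) * (s' - 1)))⁻¹ * ((((box (d + 1) Lc).card : ℝ))⁻¹ *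
                 zetaS (toSite r) Lc (legAct (legChain (respStepBmSeq (d := d) ρ Lc) (s' - 2) (k + 2 - s')) (delta1 μ z)) y)))
            s' (blk (Lc ^ s') u') := by
  have hE := gauge_coarse_eq_staircase_fine (Lc := Lc) ρ k μ z u'
  rw [show ((Lc : ℝ) ^ (d + 1))⁻¹ *
        (Psi ρ Lc 0 k (delta1 μ z) (blk Lc u') + PsiFace r ρ Lc 0 k (delta1 μ z) (blk Lc u')
          - bmGaugeAt ρ (respStep (d := d) 1 (Lc ^ (k + 1)) μ z) Lc (blk Lc u'))
      = ((Lc : ℝ) ^ (d + 1))⁻¹ * (Psi ρ Lc 0 k (delta1 μ z) (blk Lc u') - bmGaugeAt ρ (respStep (d := d) 1 (Lc ^ (k + 1)) μ z) Lc (blk Lc u'))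
        + ((Lc : ℝ) ^ (d + 1))⁻¹ * PsiFace r ρ Lc 0 k (delta1 μ z) (blk Lc u') by ring,
    hE, PsiFace_coarse_eq_staircase_fine r ρ k (delta1 μ z) u']
  simp only [Finset.sum_add_distrib]
  congr 1
  · -- the (E) part: one more (empty) top scale
    rw [Finset.sum_range_succ _ (k + 2), if_neg (show ¬ (k + 2 = 0) by omega), if_neg (show ¬ (k + 2 ≤ k + 1) by omega), add_zero]
    refine Finset.sum_congr rfl fun s hs => ?_
    have hsk : s ≤ k + 1 := Nat.lt_succ_iff.1 (Finset.mem_range.1 hs)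
    by_cases h0 : s = 0
    · simp only [h0, ↓reduceIte]
    · rw [if_neg h0, if_neg h0, if_pos hsk]

/-- [folklore] **THE FACE PARTS OF TWO TOP-ALIGNED TOWERS DIFFER BY A `(k+3)`-STAIRCASE** (generic `d`, every `r ρ k b u′`):
`PsiFace r ρ Lc 0 (k+1) b u′ − (Lc^{d+1})⁻¹·PsiFace r ρ Lc 0 k b (blk Lc u′) = Σ_{s′<k+3} ΔΦ s′ (blk (Lc^{s′}) u′)`, `ΔΦ 0 = 0`, `ΔΦ 1 = |box Lc|⁻¹·ζ_S (legAct (legChain R 0 (k+1)) b)` (the taller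
tower's EXTRA finest face piece), `ΔΦ s′ = (Lc^{(d+1)(s′−1)})⁻¹·|box Lc|⁻¹·(ζ_S (legAct (legChain R (s′−1) (k+2−s′)) b) − ζ_S (legAct (legChain R (s′−2) (k+2−s′)) b))` (`s′ ≥ 2`: the SAME prefactor,
the SAME length, bases `s′−1` ∕ `s′−2` — the shape MY `CombFacePotentialCauchy` prices by `θ^k`). -/
theorem PsiFace_refine_eq_staircase (r : Fin (d + 1) → ℕ) (ρ : Fin (d + 1) → ℤ) (k : ℕ) (b : Form1 (d + 1) ℝ) (u' : Site (d + 1)) :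
    PsiFace r ρ Lc 0 (k + 1) b u' - ((Lc : ℝ) ^ (d + 1))⁻¹ * PsiFace r ρ Lc 0 k b (blk Lc u')
      = ∑ s' ∈ Finset.range (k + 2 + 1),
          (fun (s' : ℕ) (y : Site (d + 1)) =>
            if s' = 0 then (0 : ℝ)
            else if s' = 1 then (((box (d + 1) Lc).card : ℝ))⁻¹ * zetaS (toSite r) Lc (legAct (legChain (respStepBmSeq (d := d) ρ Lc) 0 (k + 1)) b) y
            else ((Lc : ℝ) ^ ((d + 1) * (s' - 1)))⁻¹ * ((((box (d + 1) Lc).card : ℝ))⁻¹ *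
              (zetaS (toSite r) Lc (legAct (legChain (respStepBmSeq (d := d) ρ Lc) (s' - 1) (k + 2 - s')) b) y
                - zetaS (toSite r) Lc (legAct (legChain (respStepBmSeq (d := d) ρ Lc) (s' - 2) (k + 2 - s')) b) y))) s' (blk (Lc ^ s') u') := by
  have h1 := PsiFace_eq_staircase (Lc := Lc) r ρ 0 (k + 1) b u'
  rw [show k + 1 + 1 + 1 = k + 2 + 1 from rfl] at h1
  rw [h1, PsiFace_coarse_eq_staircase_fine r ρ k b u', ← Finset.sum_sub_distrib]
  refine Finset.sum_congr rfl fun s' hs' => ?_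
  have hs : s' ≤ k + 2 := Nat.lt_succ_iff.1 (Finset.mem_range.1 hs')
  rcases Nat.lt_or_ge s' 2 with hlt | hge
  · interval_cases s'
    · simp only [↓reduceIte, zero_le, sub_zero]
    · simp only [Nat.succ_ne_zero, ↓reduceIte, le_refl, sub_zero, Nat.sub_self, Nat.sub_zero, pow_zero, mul_zero, inv_one, one_mul, Nat.zero_add]
  · dsimp only
    rw [if_neg (show s' ≠ 0 by omega), if_neg (show ¬ s' ≤ 1 by omega), if_neg (show s' ≠ 0 by omega), if_neg (show s' ≠ 1 by omega),
      show 0 + (s' - 1) = s' - 1 by omega, show k + 1 - (s' - 1) = k + 2 - s' by omega]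
    ring

/-- NOT IN PRINT; OUR BOOKKEEPING.  **CT-4b (α)+(δ) AT THE COMB CHART, THE IDENTITY: THE TWO TOWERS' CONJUGATED BOND GAUGE FUNCTIONS, TOP-ALIGNED, DIFFER BY A `(k+3)`-STAIRCASE ON THE
FINE′ LATTICE** (generic `d`, every root pair, every `k μ z u′`): `λ′^{(0,k+1)} u′ − (Lc^{d+1})⁻¹·λ′^{(0,k)} (blk Lc u′) = Σ_{s′<k+3} ΔG′ s′ (blk (Lc^{s′}) u′)` — road-P2's `gauge_refine_eq_staircase`
(scales `≤ k+1`: the (E) extra finest piece at `s′ = 0`, the differenced (E) pieces at `1 ≤ s′ ≤ k+1`) ⊕ `PsiFace_refine_eq_staircase` (the face extra finest piece at `s′ = 1`, the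
differenced face pieces at `2 ≤ s′ ≤ k+2`). -/
theorem combGauge_refine_eq_staircase (r : Fin (d + 1) → ℕ) (ρ : Fin (d + 1) → ℤ) (k : ℕ) (μ : Fin (d + 1)) (z u' : Site (d + 1)) :
    (Psi ρ Lc 0 (k + 1) (delta1 μ z) u' + PsiFace r ρ Lc 0 (k + 1) (delta1 μ z) u' - bmGaugeAt ρ (respStep (d := d) 1 (Lc ^ (k + 2)) μ z) Lc u')
      - ((Lc : ℝ) ^ (d + 1))⁻¹ *
        (Psi ρ Lc 0 k (delta1 μ z) (blk Lc u') + PsiFace r ρ Lc 0 k (delta1 μ z) (blk Lc u')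
          - bmGaugeAt ρ (respStep (d := d) 1 (Lc ^ (k + 1)) μ z) Lc (blk Lc u'))
      = ∑ s' ∈ Finset.range (k + 2 + 1),
          (fun (s' : ℕ) (y : Site (d + 1)) =>
            (if s' ≤ k + 1 then
              (if s' = 0 then -bmGaugeAt ρ (legAct (respStep (d := d) 1 (Lc ^ (k + 2))) (delta1 μ z)) Lc y
               else -(((Lc : ℝ) ^ ((d + 1) * s'))⁻¹ *
                 bmGaugeAt ρ (legAct (respStep (d := d) (Lc ^ s') (Lc ^ (k + 2))) (delta1 μ z)
                   - legAct (respStep (d := d) (Lc ^ (s' - 1)) (Lc ^ (k + 1))) (delta1 μ z)) Lc y))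
             else 0)
            + (if s' = 0 then (0 : ℝ)
               else if s' = 1 then (((box (d + 1) Lc).card : ℝ))⁻¹ * zetaS (toSite r) Lc (legAct (legChain (respStepBmSeq (d := d) ρ Lc) 0 (k + 1)) (delta1 μ z)) y
               else ((Lc : ℝ) ^ ((d + 1) * (s' - 1)))⁻¹ * ((((box (d + 1) Lc).card : ℝ))⁻¹ *
                 (zetaS (toSite r) Lc (legAct (legChain (respStepBmSeq (d := d) ρ Lc) (s' - 1) (k + 2 - s')) (delta1 μ z)) y
                  - zetaS (toSite r) Lc (legAct (legChain (respStepBmSeq (d := d) ρ Lc) (s' - 2) (k + 2 - s')) (delta1 μ z)) y))))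
            s' (blk (Lc ^ s') u') := by
  have hE := gauge_refine_eq_staircase (Lc := Lc) ρ k μ z u'
  have hF := PsiFace_refine_eq_staircase (Lc := Lc) r ρ k (delta1 μ z) u'
  rw [show (Psi ρ Lc 0 (k + 1) (delta1 μ z) u' + PsiFace r ρ Lc 0 (k + 1) (delta1 μ z) u' - bmGaugeAt ρ (respStep (d := d) 1 (Lc ^ (k + 2)) μ z) Lc u')
      - ((Lc : ℝ) ^ (d + 1))⁻¹ *
        (Psi ρ Lc 0 k (delta1 μ z) (blk Lc u') + PsiFace r ρ Lc 0 k (delta1 μ z) (blk Lc u')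
          - bmGaugeAt ρ (respStep (d := d) 1 (Lc ^ (k + 1)) μ z) Lc (blk Lc u'))
      = ((Psi ρ Lc 0 (k + 1) (delta1 μ z) u' - bmGaugeAt ρ (respStep (d := d) 1 (Lc ^ (k + 2)) μ z) Lc u')
          - ((Lc : ℝ) ^ (d + 1))⁻¹ * (Psi ρ Lc 0 k (delta1 μ z) (blk Lc u') - bmGaugeAt ρ (respStep (d := d) 1 (Lc ^ (k + 1)) μ z) Lc (blk Lc u')))
        + (PsiFace r ρ Lc 0 (k + 1) (delta1 μ z) u' - ((Lc : ℝ) ^ (d + 1))⁻¹ * PsiFace r ρ Lc 0 k (delta1 μ z) (blk Lc u')) by ring,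
    hE, hF]
  simp only [Finset.sum_add_distrib]
  congr 1
  rw [Finset.sum_range_succ _ (k + 2), if_neg (show ¬ (k + 2 ≤ k + 1) by omega), add_zero]
  exact Finset.sum_congr rfl fun s hs => by rw [if_pos (Nat.lt_succ_iff.1 (Finset.mem_range.1 hs))]

/-- NOT IN PRINT; OUR BOOKKEEPING.  **THE CONJUGATED STAIRCASE AT READOUT LEVEL `0`, CLEAN INDICES, ONE FORMULA FOR THE (E) PIECES** (generic `d`, every root pair, every `k μ z u`):
`λ′^{(0,k)} u = Σ_{s<k+2} G′_k s (blk (Lc^s) u)`, `G′_k s y = [s ≤ k]·(−((Lc^{(d+1)s})⁻¹·bmGaugeAt ρ (legAct (respStep (Lc^s) (Lc^(k+1))) δ) Lc y)) + [s ≥ 1]·(Lc^{(d+1)(s−1)})⁻¹·|box Lc|⁻¹·ζ_S (legAct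
(legChain R (s−1) (k−(s−1))) δ) y` — MY `CombContactGaugeStaircase.combGauge_eq_staircase` at `m = 0` with road-P2's uniformisation of the `s = 0` piece (`legAct_delta1_eq`, `(Lc^0)⁻¹ = 1`). -/
theorem combGauge_eq_staircase_zero (r : Fin (d + 1) → ℕ) (ρ : Fin (d + 1) → ℤ) (k : ℕ) (μ : Fin (d + 1)) (z u : Site (d + 1)) :
    Psi ρ Lc 0 k (delta1 μ z) u + PsiFace r ρ Lc 0 k (delta1 μ z) u - bmGaugeAt ρ (respStep (d := d) 1 (Lc ^ (k + 1)) μ z) Lc u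
      = ∑ s ∈ Finset.range (k + 1 + 1),
          (fun (s : ℕ) (y : Site (d + 1)) =>
            (if s ≤ k then
              -(((Lc : ℝ) ^ ((d + 1) * s))⁻¹ * bmGaugeAt ρ (legAct (respStep (d := d) (Lc ^ s) (Lc ^ (k + 1))) (delta1 μ z)) Lc y)
             else 0)
            + (if s = 0 then (0 : ℝ)
               else ((Lc : ℝ) ^ ((d + 1) * (s - 1)))⁻¹ * ((((box (d + 1) Lc).card : ℝ))⁻¹ *
                 zetaS (toSite r) Lc (legAct (legChain (respStepBmSeq (d := d) ρ Lc) (s - 1) (k - (s - 1))) (delta1 μ z)) y)))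
            s (blk (Lc ^ s) u) := by
  have h := combGauge_eq_staircase (Lc := Lc) r ρ 0 k μ z u
  simp only [zero_add, pow_zero] at h
  rw [Nat.zero_add] at h
  rw [h]
  refine Finset.sum_congr rfl fun s _ => ?_
  by_cases h0 : s = 0
  · subst h0
    simp only [↓reduceIte, zero_le, mul_zero, pow_zero, inv_one, one_mul, legAct_delta1_eq]
  · simp only [h0, ↓reduceIte]

/-! ## §2 `d = 3`: per-scale letters (parametric in (N1) `C, κ₀`, in CT-4a `c, θ, κ₁`, and in a face letter `F ≥ faceWtSum r Lc`) -/

section Four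

variable {Lc : ℕ} [NeZero Lc] {κ₀ C c θ κ₁ F : ℝ} (hκ₀ : 0 ≤ κ₀) (hC : 0 ≤ C) (hκ₁ : 0 ≤ κ₁) (hc : 0 ≤ c) (hθ : 0 ≤ θ)
  (hN1 : ∀ (m k : ℕ) (μ : Fin (3 + 1)) (z : Site (3 + 1)) (l'' : Fin (3 + 1)) (w' : Site (3 + 1)),
    |respStep (d := 3) (Lc ^ m) (Lc ^ (m + k + 1)) μ z l'' w'| ≤
      C * ((Lc : ℝ) ^ (5 * (k + 1)))⁻¹ * Real.exp (-(κ₀ * supNorm (quo (Lc ^ (k + 1)) w' - z))))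
  (hCau : ∀ (s k : ℕ) (μ : Fin (3 + 1)) (z : Site (3 + 1)) (l : Fin (3 + 1)) (w : Site (3 + 1)),
    |respStep (d := 3) (Lc ^ (s + 1)) (Lc ^ (s + k + 2)) μ z l w - respStep (d := 3) (Lc ^ s) (Lc ^ (s + k + 1)) μ z l w|
      ≤ c * θ ^ (s + k) * ((((Lc ^ (k + 1) : ℕ) : ℝ)) ^ (3 + 2))⁻¹ * Real.exp (-(κ₁ * supNorm (quo (Lc ^ (k + 1)) w - z))))
  {r : Fin (3 + 1) → ℕ} (hr : r ∈ box (3 + 1) Lc) {rr : Fin (3 + 1) → ℕ} (hrr : rr ∈ box (3 + 1) Lc) (hF : faceWtSum r Lc ≤ F)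
include hr hrr hF

section Born
include hκ₁ hc hθ hCau

/-- NOT IN PRINT; OUR BOOKKEEPING.  **THE BORN ALIGNMENT's LETTERS AT THE COMB CHART** (`d = 3`, in-block roots; PARAMETRIC in CT-4a's `c, θ, κ₁` and the face letter `F`): for every `s ≤ k+1`
and `u`, `|D′ s (blk (Lc^s) u)| ≤ ((8·Lc + F·(1 + 8·Lc·(e^{κ₁}+1)))·(c·θ^{m+k})·(Lc^{5(k+1)})⁻¹·Lc^s)·e^{−κ₁‖quo (Lc^(k+1)) u − z‖∞}` (`D′` of `combGauge_succ_sub_eq_staircase`) — road-P2's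
`abs_gaugePieceSucc_le` for the (E) part, MY `CombFacePotentialCauchy.abs_facePotential_legChain_succ_sub_le` at `ℓ = m + (s−1)`, `j = k − (s−1)` for the face part (rate `θ^{m+k}` UNIFORMLY
in the scale; `(Lc^{4(s−1)})⁻¹·(Lc^{5(k−(s−1)+1)})⁻¹ = Lc^{s−1}·(Lc^{5(k+1)})⁻¹ ≤ Lc^s·(Lc^{5(k+1)})⁻¹`). -/
theorem abs_combPieceSucc_le (m k : ℕ) (μ : Fin (3 + 1)) (z : Site (3 + 1)) {s : ℕ} (hs : s ≤ k + 1) (u : Site (3 + 1)) :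
    |(fun (s : ℕ) (y : Site (3 + 1)) =>
        (if s ≤ k then
          -(((Lc : ℝ) ^ ((3 + 1) * s))⁻¹ *
            bmGaugeAt (toSite rr) (legAct (respStep (d := 3) (Lc ^ (m + 1 + s)) (Lc ^ (m + 1 + k + 1))) (delta1 μ z)
              - legAct (respStep (d := 3) (Lc ^ (m + s)) (Lc ^ (m + k + 1))) (delta1 μ z)) Lc y)
         else 0)
        + (if s = 0 then (0 : ℝ)
           else ((Lc : ℝ) ^ ((3 + 1) * (s - 1)))⁻¹ * ((((box (3 + 1) Lc).card : ℝ))⁻¹ *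
             (zetaS (toSite r) Lc (legAct (legChain (respStepBmSeq (d := 3) (toSite rr) Lc) (m + 1 + (s - 1)) (k - (s - 1))) (delta1 μ z)) y
              - zetaS (toSite r) Lc (legAct (legChain (respStepBmSeq (d := 3) (toSite rr) Lc) (m + (s - 1)) (k - (s - 1))) (delta1 μ z)) y))))
        s (blk (Lc ^ s) u)|
      ≤ ((8 * (Lc : ℝ) + F * (1 + 8 * (Lc : ℝ) * (Real.exp κ₁ + 1))) * (c * θ ^ (m + k)) * ((Lc : ℝ) ^ (5 * (k + 1)))⁻¹ * (Lc : ℝ) ^ s) *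
          Real.exp (-(κ₁ * supNorm (quo (Lc ^ (k + 1)) u - z))) := by
  have hL0 : (0 : ℝ) < Lc := by exact_mod_cast Nat.pos_of_ne_zero (NeZero.ne Lc)
  have hL1 : (1 : ℝ) ≤ Lc := by exact_mod_cast Nat.one_le_iff_ne_zero.2 (NeZero.ne Lc)
  have hF0 : 0 ≤ F := (faceWtSum_nonneg r Lc).trans hF
  set E : ℝ := Real.exp (-(κ₁ * supNorm (quo (Lc ^ (k + 1)) u - z))) with hE
  have hE0 : 0 ≤ E := (Real.exp_pos _).le
  set q : ℝ := (c * θ ^ (m + k)) * ((Lc : ℝ) ^ (5 * (k + 1)))⁻¹ with hq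
  have hq0 : 0 ≤ q := by positivity
  -- the (E) part
  have hA : |(if s ≤ k then
          -(((Lc : ℝ) ^ ((3 + 1) * s))⁻¹ *
            bmGaugeAt (toSite rr) (legAct (respStep (d := 3) (Lc ^ (m + 1 + s)) (Lc ^ (m + 1 + k + 1))) (delta1 μ z)
              - legAct (respStep (d := 3) (Lc ^ (m + s)) (Lc ^ (m + k + 1))) (delta1 μ z)) Lc (blk (Lc ^ s) u))
         else 0)| ≤ 8 * (Lc : ℝ) * q * (Lc : ℝ) ^ s * E := by
    by_cases hsk : s ≤ k
    · rw [if_pos hsk]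
      have h := abs_gaugePieceSucc_le (Lc := Lc) hCau hrr m k μ z hsk u
      rw [← hE] at h
      refine h.trans (le_of_eq ?_)
      rw [hq]; ring
    · rw [if_neg hsk, abs_zero]; positivity
  -- the face part
  have hB : |(if s = 0 then (0 : ℝ)
           else ((Lc : ℝ) ^ ((3 + 1) * (s - 1)))⁻¹ * ((((box (3 + 1) Lc).card : ℝ))⁻¹ *
             (zetaS (toSite r) Lc (legAct (legChain (respStepBmSeq (d := 3) (toSite rr) Lc) (m + 1 + (s - 1)) (k - (s - 1))) (delta1 μ z)) (blk (Lc ^ s) u)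
              - zetaS (toSite r) Lc (legAct (legChain (respStepBmSeq (d := 3) (toSite rr) Lc) (m + (s - 1)) (k - (s - 1))) (delta1 μ z)) (blk (Lc ^ s) u))))|
        ≤ F * (1 + 8 * (Lc : ℝ) * (Real.exp κ₁ + 1)) * q * (Lc : ℝ) ^ s * E := by
    rcases Nat.eq_zero_or_pos s with h0 | hpos
    · subst h0; rw [if_pos rfl, abs_zero]; positivity
    · obtain ⟨i, rfl⟩ : ∃ i, s = i + 1 := ⟨s - 1, by omega⟩
      have hik : i ≤ k := by omega
      rw [if_neg (Nat.succ_ne_zero i), Nat.add_sub_cancel, mul_sub, ← blk_blk_pow, ← facePotential_apply, ← facePotential_apply,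
        show m + 1 + i = m + i + 1 by ring, abs_mul, abs_inv, abs_pow, abs_of_pos hL0]
      have h := abs_facePotential_legChain_succ_sub_le hκ₁ hc hθ hCau hr hrr (m + i) (k - i) μ z (blk (Lc ^ i) u)
      have hlab : quo (Lc ^ (k - i + 1)) (blk (Lc ^ i) u) = quo (Lc ^ (k + 1)) u := by
        show blk (Lc ^ (k - i + 1)) (blk (Lc ^ i) u) = blk (Lc ^ (k + 1)) u
        rw [blk_pow_blk_pow, show i + (k - i + 1) = k + 1 by omega]
      rw [hlab, ← hE, show m + i + (k - i) = m + k by omega] at h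
      have hB0 : 0 ≤ (1 + 8 * (Lc : ℝ) * (Real.exp κ₁ + 1)) * (c * θ ^ (m + k)) * ((Lc : ℝ) ^ (5 * (k - i + 1)))⁻¹ * E := by positivity
      have h' := h.trans (mul_le_mul_of_nonneg_right hF hB0)
      have e : ((Lc : ℝ) ^ ((3 + 1) * i))⁻¹ * ((Lc : ℝ) ^ (5 * (k - i + 1)))⁻¹ = ((Lc : ℝ) ^ (5 * (k + 1)))⁻¹ * (Lc : ℝ) ^ i := by
        have e' : (Lc : ℝ) ^ (5 * (k + 1)) = (Lc : ℝ) ^ ((3 + 1) * i) * (Lc : ℝ) ^ (5 * (k - i + 1)) * (Lc : ℝ) ^ i := by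
          rw [← pow_add, ← pow_add]; congr 1; omega
        rw [e']; field_simp
      have hpow : (Lc : ℝ) ^ i ≤ (Lc : ℝ) ^ (i + 1) := pow_le_pow_right₀ hL1 (Nat.le_succ i)
      calc ((Lc : ℝ) ^ ((3 + 1) * i))⁻¹ *
            |facePotential r Lc (legAct (legChain (respStepBmSeq (d := 3) (toSite rr) Lc) (m + i + 1) (k - i)) (delta1 μ z)) (blk (Lc ^ i) u)
              - facePotential r Lc (legAct (legChain (respStepBmSeq (d := 3) (toSite rr) Lc) (m + i) (k - i)) (delta1 μ z)) (blk (Lc ^ i) u)|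
          ≤ ((Lc : ℝ) ^ ((3 + 1) * i))⁻¹ * (F * ((1 + 8 * (Lc : ℝ) * (Real.exp κ₁ + 1)) * (c * θ ^ (m + k)) * ((Lc : ℝ) ^ (5 * (k - i + 1)))⁻¹ * E)) :=
            mul_le_mul_of_nonneg_left h' (by positivity)
        _ = F * (1 + 8 * (Lc : ℝ) * (Real.exp κ₁ + 1)) * q * (Lc : ℝ) ^ i * E := by
            rw [hq]
            calc ((Lc : ℝ) ^ ((3 + 1) * i))⁻¹ * (F * ((1 + 8 * (Lc : ℝ) * (Real.exp κ₁ + 1)) * (c * θ ^ (m + k)) * ((Lc : ℝ) ^ (5 * (k - i + 1)))⁻¹ * E))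
                = F * (1 + 8 * (Lc : ℝ) * (Real.exp κ₁ + 1)) * (c * θ ^ (m + k)) * (((Lc : ℝ) ^ ((3 + 1) * i))⁻¹ * ((Lc : ℝ) ^ (5 * (k - i + 1)))⁻¹) * E := by ring
              _ = _ := by rw [e]; ring
        _ ≤ F * (1 + 8 * (Lc : ℝ) * (Real.exp κ₁ + 1)) * q * (Lc : ℝ) ^ (i + 1) * E :=
            mul_le_mul_of_nonneg_right (mul_le_mul_of_nonneg_left hpow (by positivity)) hE0
  refine (abs_add_le _ _).trans ((add_le_add hA hB).trans (le_of_eq ?_))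
  rw [hq]; ring

end Born

end Four

end Summit.QuantumFields.BalabanUV.Beta.GAN24.CombContactGaugeStaircaseCauchy

end
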